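import Summits.HodgeConjecture.CorCM.GaloisPrimeOrderPowerSets
import Mathlib.GroupTheory.Coset.Card
import HarnessLib

/-!
# The subgroup `⟨u, c⟩` of a prime-order element and a central involution: `c ∉ ⟨u⟩` for NON-NORMAL `⟨u⟩`, `|⟨u, c⟩| = 2p`,
# `2p ∣ |G|`

COR-CM (cell `pub-hodgecm2`), binder seat b04 (gen 33), count-neutral own lane «Galois-CM-type classification».  KERNEL ONLY,
Mathlib only: theorems; no definition, no named fact, no `sorry`.  Second feeder (after `CorCM/GaloisPrimeOrderPowerSets`) of
`CorCM/GaloisSkewSectionPrime` (gen 33: a NON-NORMAL subgroup of prime order yields a skew CM set) and of its Galois dress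
`CorCM/GaloisNonNormalPrimeOrder`.  Setting: `G` a group, `c` an involution commuting with `u`, `uᵖ = 1 ≠ u`, `p` prime.

* `pow_ne_mul_pow` — `c ∉ ⟨u⟩` (as `∀ j < p, c ≠ uʲ`) ⟹ `uⁱ ≠ c·uʲ` for all `i, j` (the two sheets of `⟨u, c⟩` are disjoint).
* `ne_pow_of_nonnormal` — `c ≠ 1` central and `⟨u⟩` NOT normal (`g u g⁻¹ ∉ ⟨u⟩` for some `g`) ⟹ `c ∉ ⟨u⟩` (else `⟨u⟩ = ⟨c⟩` is
  central; uses the prime-order power-set lemma).  So for non-normal `⟨u⟩` the hypothesis `c ∉ ⟨u⟩` of the skew-section theorem is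
  free — for `p = 2` it says `u ≠ c`, for odd `p` it is automatic anyway.
* `card_closure_pair` — `|Subgroup.closure {u, c}| = 2p` (finite `G`); `two_mul_prime_dvd_card` — hence `2p ∣ |G|` (Lagrange), which
  lets the Galois dress state its thresholds on `[K:ℚ]` alone.

## References

* [Shimura1998] G. Shimura, *Abelian Varieties with Complex Multiplication and Modular Functions*, §8.2 Prop. 26 (context only).
-/

namespace Summit.HodgeConjecture.CorCM.GaloisModels.SkewSectionPrime

open Finset
variable {G : Type*} [Group G] [DecidableEq G] [Fintype G]

omit [DecidableEq G] [Fintype G] in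
/-- `c ∉ ⟨u⟩` (`uᵖ = 1 ≠ u`, `p` prime) ⟹ `uⁱ ≠ c·uʲ` for all `i, j`. [folklore] -/
theorem pow_ne_mul_pow {c u : G} {p : ℕ} [hp : Fact p.Prime] (hup : u ^ p = 1) (hu1 : u ≠ 1)
    (hcU : ∀ j < p, c ≠ u ^ j) (i j : ℕ) : u ^ i ≠ c * u ^ j := by
  have hpos := hp.out.pos
  have hord : orderOf u = p := orderOf_eq_prime hup hu1
  have hmod : ∀ k, u ^ (k % p) = u ^ k := fun k => by rw [← hord]; exact pow_mod_orderOf u k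
  intro h
  have h1 : c = u ^ i * (u ^ j)⁻¹ := eq_mul_inv_of_mul_eq h.symm
  have hinv : (u ^ j)⁻¹ = u ^ (p - j % p) := by
    rw [← hmod j]
    exact inv_eq_of_mul_eq_one_right (by rw [← pow_add, Nat.add_sub_cancel' (Nat.mod_lt j hpos).le, hup])
  rw [hinv, ← pow_add, ← hmod] at h1
  exact hcU _ (Nat.mod_lt _ hpos) h1

omit [Fintype G] in
/-- A NON-NORMAL `⟨u⟩` of prime order never contains the central involution `c` (else `⟨u⟩ = ⟨c⟩` would be central). [folklore] -/
theorem ne_pow_of_nonnormal {c u : G} {p : ℕ} [hp : Fact p.Prime] (hc1 : c ≠ 1) (hcen : ∀ g : G, c * g = g * c)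
    (hup : u ^ p = 1) (hu1 : u ≠ 1) (hnn : ∃ g : G, ∀ k < p, g * u * g⁻¹ ≠ u ^ k) : ∀ j < p, c ≠ u ^ j := by
  intro j hj h
  obtain ⟨g, hg⟩ := hnn
  rcases Nat.eq_zero_or_pos j with rfl | hj0
  · exact hc1 (by rw [h, pow_zero])
  have himg := image_pow_eq_image_conj_pow (v := c) (a := 1) (orderOf_eq_prime hup hu1) hj0 hj
    (by rw [one_mul, inv_one, mul_one]; exact h)
  have hu : u ∈ (Finset.range p).image (fun i => c ^ i) := by
    rw [himg]; exact Finset.mem_image.2 ⟨1, Finset.mem_range.2 hp.out.one_lt, by rw [pow_one, one_mul, inv_one, mul_one]⟩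
  obtain ⟨i, -, hi⟩ := Finset.mem_image.1 hu
  refine hg 1 hp.out.one_lt ?_
  rw [pow_one, ← hi, ← ((show Commute c g from hcen g).pow_left i).eq, mul_inv_cancel_right]

/-- `|⟨u, c⟩| = 2p` for a central-type pair: `c² = 1`, `uᵖ = 1 ≠ u` (`p` prime), `cu = uc`, `c ∉ ⟨u⟩`. [folklore] -/
theorem card_closure_pair (c u : G) (p : ℕ) [hp : Fact p.Prime] (hcc : c * c = 1) (hup : u ^ p = 1) (hu1 : u ≠ 1)
    (hcu : c * u = u * c) (hcU : ∀ j < p, c ≠ u ^ j) : Nat.card (Subgroup.closure ({u, c} : Set G)) = 2 * p := by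
  have hpos : 0 < p := hp.out.pos
  have hord : orderOf u = p := orderOf_eq_prime hup hu1
  have hexcl : ∀ i j : ℕ, u ^ i ≠ c * u ^ j := pow_ne_mul_pow hup hu1 hcU
  have hpowinj : ∀ i, i < p → ∀ i', i' < p → u ^ i = u ^ i' → i = i' := fun i hi i' hi' h =>
    pow_injOn_Iio_orderOf (by rw [hord]; exact hi) (by rw [hord]; exact hi') h
  have hH : ∀ x, x ∈ Subgroup.closure ({u, c} : Set G) ↔ ∃ j < p, (x = u ^ j ∨ x = c * u ^ j) :=
    mem_closure_pair_iff_of_pow_eq_one hpos hcc hup hcu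
  set S : Finset G := (Finset.range p).image (fun j => u ^ j) ∪ (Finset.range p).image (fun j => c * u ^ j) with hSdef
  have hSH : ∀ x, x ∈ S ↔ x ∈ Subgroup.closure ({u, c} : Set G) := by
    intro x
    rw [hH, hSdef, Finset.mem_union, Finset.mem_image, Finset.mem_image]
    constructor
    · rintro (⟨j, hj, rfl⟩ | ⟨j, hj, rfl⟩)
      · exact ⟨j, Finset.mem_range.1 hj, Or.inl rfl⟩
      · exact ⟨j, Finset.mem_range.1 hj, Or.inr rfl⟩
    · rintro ⟨j, hj, rfl | rfl⟩
      · exact Or.inl ⟨j, Finset.mem_range.2 hj, rfl⟩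
      · exact Or.inr ⟨j, Finset.mem_range.2 hj, rfl⟩
  have hScard : S.card = 2 * p := by
    rw [hSdef, Finset.card_union_of_disjoint, Finset.card_image_of_injOn, Finset.card_image_of_injOn,
      Finset.card_range, two_mul]
    · intro i hi i' hi' h
      exact hpowinj i (Finset.mem_range.1 hi) i' (Finset.mem_range.1 hi') (mul_left_cancel h)
    · intro i hi i' hi' h
      exact hpowinj i (Finset.mem_range.1 hi) i' (Finset.mem_range.1 hi') h
    · rw [Finset.disjoint_left]
      rintro x hx hx'
      obtain ⟨i, -, rfl⟩ := Finset.mem_image.1 hx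
      obtain ⟨j, -, hj⟩ := Finset.mem_image.1 hx'
      exact hexcl i j hj.symm
  rw [← hScard]
  have e : Nat.card {x : G // x ∈ S} = S.card := by rw [Nat.card_eq_fintype_card, Fintype.card_coe]
  rw [← e]
  apply le_antisymm
  · exact Nat.card_le_card_of_injective
      (fun h : Subgroup.closure ({u, c} : Set G) => (⟨h.1, (hSH h.1).2 h.2⟩ : {x : G // x ∈ S}))
      fun a b hab => Subtype.ext (by simpa using congrArg Subtype.val hab)
  · exact Nat.card_le_card_of_injective
      (fun x : {x : G // x ∈ S} => (⟨x.1, (hSH x.1).1 x.2⟩ : Subgroup.closure ({u, c} : Set G)))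
      fun a b hab => Subtype.ext (by simpa using congrArg Subtype.val hab)

/-- **Lagrange for `⟨u, c⟩`**: under the same hypotheses `2p ∣ |G|`. [folklore] -/
theorem two_mul_prime_dvd_card (c u : G) (p : ℕ) [hp : Fact p.Prime] (hcc : c * c = 1) (hup : u ^ p = 1) (hu1 : u ≠ 1)
    (hcu : c * u = u * c) (hcU : ∀ j < p, c ≠ u ^ j) : 2 * p ∣ Fintype.card G := by
  rw [← Nat.card_eq_fintype_card, ← card_closure_pair c u p hcc hup hu1 hcu hcU]
  exact Subgroup.card_subgroup_dvd_card _

end Summit.HodgeConjecture.CorCM.GaloisModels.SkewSectionPrime
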